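import Summits.HubbardSuperconductivity.HubbardSuperconductivity.Theorems.KLProgrammeKLRegimeScaleZeroCovarianceEntryAbelBound
import Summits.HubbardSuperconductivity.HubbardSuperconductivity.Theorems.KLProgrammeKLRegimeScaleZeroWeightedSizesCore
import Summits.HubbardSuperconductivity.HubbardSuperconductivity.Theorems.KLProgrammeKLRegimeEngineScaleZeroE4Defs

/-!
# Route `KLProgramme`, crux K3 — engine-flow child (stmt-HubbardSuperconductivity-20437), stub (C) at `n = 0`, located brick «A-SIZES-WEIGHTED» (pen (R181)),
# brick 4e (i): THE DECAY SHAPE OF THE ENTRIES of `S_{4M}ᵀ C⁰_{>e₀} S_{4M}` — edge/decay combination and the explicit on-site/off-site constants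

Cell gate-hubbard-kl, seat p1 g21.  The hypotheses `hrow/hcol` of p1 g18's `twoLeg_offDiag_moment_pow_sum_tail3_frameZero_le(_booked)` (…ScaleZeroTwoLegTail3 /
…Tail3OnSite), i.e. `Σ_Y ‖C X Y‖·(1+λ·d(X,Y))^k ≤ a·4M/β` for the pair value `d = gridLabelDist` (periodic time distance + torus `ℓ^∞` distance), from:
the pointwise bounds of brick 4c (Gram `16`, off-site uniform, Abel time decay with frequency jets to order `N′ = k+2`), the decay/edge combination
`‖E‖ ≤ [v≠0]·ED/v + max(G, BK/ℓ^{N′})·2^{N′}·(1+εv/ℓ)^{−N′}` (any `ℓ > 0`; **`le_add_max_mul_of_bounds`**), and the core lemma of brick 4d.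

* `norm_gridCov_apply_le_shape_of_freqJets` (oriented, generic jets `A_i` and uniform bound `G`);
* **`norm_gridCov_apply_le_decayShape`** — both orientations with the EXPLICIT on-site/off-site constants (table `klChi2CauchyTab`, lattice sums
  `S_m = Σ'_{z∈ℤ²}(1+‖z‖_∞)^{−m}`, `e₀ = klE0`), in the pointwise format of brick 4d's core lemma; the sums `hrow/hcol` follow in brick 4e (ii).

Proofs only; no definitions; nothing here asserts (C), any stub of 20437, K3 or superconductivity.
References: BGM 2006 §2.2 (2.36aa), §2.4 (2.77)–(2.80) [cite: BenfattoGiulianiMastropietro2006]; de Siqueira Pedra–Salmhofer 2008 §4 Cor. 4.4 [cite: PedraSalmhofer2008].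
-/

noncomputable section

namespace Summit.HubbardSuperconductivity.HubbardSuperconductivity.Theorems.KLRegimeSplit

set_option linter.dupNamespace false -- summit = problem name (single-conjunct summit), D-0017

open Literature.MathematicalPhysics.QuantumLattice Literature.Probability.LatticeModels Literature.Analysis.FunctionSpaces
open Summit.HubbardSuperconductivity.HubbardSuperconductivity.Theorems.DispersionFlow
open Summit.HubbardSuperconductivity.HubbardSuperconductivity.Theorems.EngineV8 (gridLabelDist gridLegPos gridLabelDist_apply gridLegPos_apply
  isLabelDist_gridLabelDist klEngL₃)
open Finset Real
open scoped Nat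

variable {L M : ℕ} [NeZero L] [NeZero M]

/-! ## §1 The pointwise decay shape of the entries -/

omit [NeZero L] [NeZero M] in
/-- **Edge/decay combination**: `E ≤ G` and `E ≤ ED + BK/d^{N′}` (`d, ℓ > 0`, `G, ED ≥ 0`) give
`E ≤ ED + max(G, BK/ℓ^{N′})·2^{N′}·(1 + d/ℓ)^{−N′}`. -/
theorem le_add_max_mul_of_bounds {E G ED BK d ℓ : ℝ} (N' : ℕ) (hℓ : 0 < ℓ) (hd : 0 < d) (hG0 : 0 ≤ G) (hED : 0 ≤ ED)
    (hG : E ≤ G) (hA : E ≤ ED + BK / d ^ N') : E ≤ ED + max G (BK / ℓ ^ N') * 2 ^ N' * ((1 + d / ℓ) ^ N')⁻¹ := by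
  have hmax0 : 0 ≤ max G (BK / ℓ ^ N') := le_max_of_le_left hG0
  have hq : 0 < 1 + d / ℓ := by positivity
  rcases le_or_gt d ℓ with hdl | hdl
  · -- near: `E ≤ G ≤ max · 2^{N′}/(1+d/ℓ)^{N′}` since `1 + d/ℓ ≤ 2`
    have hdl' : d / ℓ ≤ 1 := (div_le_one hℓ).2 hdl
    have h2 : (1 + d / ℓ) ^ N' ≤ 2 ^ N' := pow_le_pow_left₀ hq.le (by linarith) N'
    have h3 : 1 ≤ 2 ^ N' * ((1 + d / ℓ) ^ N')⁻¹ := by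
      rw [← div_eq_mul_inv, one_le_div (by positivity)]; exact h2
    calc E ≤ G := hG
      _ ≤ max G (BK / ℓ ^ N') * 1 := by rw [mul_one]; exact le_max_left _ _
      _ ≤ max G (BK / ℓ ^ N') * (2 ^ N' * ((1 + d / ℓ) ^ N')⁻¹) := mul_le_mul_of_nonneg_left h3 hmax0
      _ ≤ ED + max G (BK / ℓ ^ N') * 2 ^ N' * ((1 + d / ℓ) ^ N')⁻¹ := by rw [mul_assoc]; linarith
  · -- far: `BK/d^{N′} = (BK/ℓ^{N′})(ℓ/d)^{N′} ≤ max · (2/(1+d/ℓ))^{N′}`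
    have hr : ℓ / d ≤ 2 / (1 + d / ℓ) := by
      rw [div_le_div_iff₀ hd hq]
      have : ℓ * (1 + d / ℓ) = ℓ + d := by field_simp
      nlinarith
    have h1 : BK / d ^ N' = BK / ℓ ^ N' * (ℓ / d) ^ N' := by
      rw [div_pow]; field_simp
    have h2 : BK / d ^ N' ≤ max G (BK / ℓ ^ N') * 2 ^ N' * ((1 + d / ℓ) ^ N')⁻¹ := by
      rw [h1, mul_assoc, ← div_eq_mul_inv, ← div_pow]
      exact mul_le_mul (le_max_right _ _) (pow_le_pow_left₀ (by positivity) hr N') (by positivity) hmax0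
    linarith

/-- **Oriented decay shape from jets**: on the `4M` grid at the bare frame (`Λ = klE0`), with `N′ ≥ 1`, `M ≥ 2N′+1`, `0 < β`, `ℓ > 0`, a representative `z` of
`x₁ − x₀`, jets `‖∂_ωⁱH¹_z‖ ≤ A_i/m^{i+1}` (`i ≤ N′`, `A_i ≥ 0`) and a uniform bound `‖A((p₁,σ,+),(p₀,σ,−))‖ ≤ G` (`G ≥ 0`):
`‖A((p₁,σ,+),(p₀,σ,−))‖ ≤ [v ≠ 0]·(Σ_{i<N′} 2max(i,1)2ⁱA_i/π)/v + max(G, N′A_{N′}(π/e₀)^{N′}/ℓ^{N′})·2^{N′}·(1 + (β/4M)v/ℓ)^{−N′}`, `v = cyclicDist_{4M}(j₁,j₀)`. -/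
theorem norm_gridCov_apply_le_shape_of_freqJets {β : ℝ} (hβ : 0 < β) (μ : ℝ) {N' : ℕ} (hN' : 1 ≤ N') (hM : 2 * N' + 1 ≤ M)
    (p₁ p₀ : GridPoint L (2 * (2 * M))) (σ : Fin 2) {z : Site 2} (hzx : Torus.proj L z = p₁.2 - p₀.2) {A : ℕ → ℝ} (hA0 : ∀ i, 0 ≤ A i)
    (hjet : ∀ i ≤ N', ∀ om : ℝ, ‖iteratedDeriv i (fun om : ℝ => torusFourierInv (fun kv : TorusSite 2 L =>
        (fun y : Momentum => uvSymbolFn 1 klE0 (frameLevel μ 0 ((2 * π) • y)) om) (WithLp.toLp 2 fun i => ((kv i).val : ℝ) / L)) (Torus.proj L z)) om‖ ≤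
      A i / max |om| (klE0 / 2) ^ (i + 1))
    {G : ℝ} (hG0 : 0 ≤ G)
    (hG : ‖((hubbardGridSub L M β (2 * (2 * M))).transpose * hubbardCovAboveCT L M β μ 0 0 klE0 * hubbardGridSub L M β (2 * (2 * M)))
        ((p₁, σ), 0) ((p₀, σ), 1)‖ ≤ G) {ℓ : ℝ} (hℓ : 0 < ℓ) :
    ‖((hubbardGridSub L M β (2 * (2 * M))).transpose * hubbardCovAboveCT L M β μ 0 0 klE0 * hubbardGridSub L M β (2 * (2 * M)))
        ((p₁, σ), 0) ((p₀, σ), 1)‖ ≤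
      (if cyclicDist (2 * (2 * M)) (((p₁.1 : ℕ) : ZMod (2 * (2 * M)))) (((p₀.1 : ℕ) : ZMod (2 * (2 * M)))) = 0 then 0 else
        (∑ i ∈ Finset.range N', 2 * ((max i 1 : ℕ) : ℝ) * 2 ^ i * A i / π) /
          cyclicDist (2 * (2 * M)) (((p₁.1 : ℕ) : ZMod (2 * (2 * M)))) (((p₀.1 : ℕ) : ZMod (2 * (2 * M))))) +
      max G (N' * A N' * (π / klE0) ^ N' / ℓ ^ N') * 2 ^ N' *
        ((1 + β / ((2 * (2 * M) : ℕ) : ℝ) * cyclicDist (2 * (2 * M)) (((p₁.1 : ℕ) : ZMod (2 * (2 * M)))) (((p₀.1 : ℕ) : ZMod (2 * (2 * M)))) / ℓ)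
          ^ N')⁻¹ := by
  haveI : NeZero (2 * (2 * M)) := ⟨by have := NeZero.ne M; omega⟩
  have hE0 : (0 : ℝ) < klE0 := by norm_num [klE0]
  have hMpos : (0 : ℝ) < M := by exact_mod_cast Nat.pos_of_ne_zero (NeZero.ne M)
  have hN4 : (((2 * (2 * M) : ℕ) : ℝ)) = 2 ^ 2 * M := by push_cast; ring
  set v : ℝ := cyclicDist (2 * (2 * M)) (((p₁.1 : ℕ) : ZMod (2 * (2 * M)))) (((p₀.1 : ℕ) : ZMod (2 * (2 * M)))) with hv
  have hv0 : 0 ≤ v := (isLabelDist_cyclicDist _).nonneg _ _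
  have hEDsum0 : 0 ≤ ∑ i ∈ Finset.range N', 2 * ((max i 1 : ℕ) : ℝ) * 2 ^ i * A i / π :=
    Finset.sum_nonneg fun i _ => by have := hA0 i; positivity
  have hmax0 : 0 ≤ max G (N' * A N' * (π / klE0) ^ N' / ℓ ^ N') := le_max_of_le_left hG0
  by_cases hv00 : v = 0
  · -- equal grid times: the uniform bound
    rw [if_pos hv00, zero_add, hv00, mul_zero, zero_div, add_zero, one_pow, inv_one, mul_one]
    exact hG.trans ((le_max_left _ _).trans (le_mul_of_one_le_right hmax0 (one_le_pow₀ (by norm_num))))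
  · rw [if_neg hv00]
    -- `v` is a positive natural number
    have hne : min ((((p₁.1 : ℕ) : ZMod (2 * (2 * M))) - ((p₀.1 : ℕ) : ZMod (2 * (2 * M)))).val)
        (2 * (2 * M) - ((((p₁.1 : ℕ) : ZMod (2 * (2 * M))) - ((p₀.1 : ℕ) : ZMod (2 * (2 * M)))).val)) ≠ 0 := fun h =>
      hv00 (by rw [hv, cyclicDist, h, Nat.cast_zero])
    have hv1 : 1 ≤ v := by
      rw [hv, cyclicDist]; exact Nat.one_le_cast.2 (Nat.one_le_iff_ne_zero.2 hne)
    have hvpos : 0 < v := by linarith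
    -- the Abel bound
    have hAbel := norm_gridCov_apply_le_of_freqJets (L := L) (M := M) hβ μ hE0 hN' hM p₁ p₀ σ hzx hA0 hjet hvpos
    -- edges: `v^{i+1} ≥ v`
    have hedges : ∑ i ∈ Finset.range N', 2 * ((max i 1 : ℕ) : ℝ) * 2 ^ i * A i / (π * v ^ (i + 1)) ≤
        (∑ i ∈ Finset.range N', 2 * ((max i 1 : ℕ) : ℝ) * 2 ^ i * A i / π) / v := by
      rw [Finset.sum_div]
      refine Finset.sum_le_sum fun i _ => ?_
      rw [div_div]
      refine div_le_div_of_nonneg_left (by have := hA0 i; positivity) (by positivity) ?_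
      refine mul_le_mul_of_nonneg_left ?_ Real.pi_pos.le
      calc v = v ^ 1 := (pow_one v).symm
        _ ≤ v ^ (i + 1) := pow_le_pow_right₀ hv1 (by omega)
    -- bulk: `= N′A(π/e₀)^{N′} / ((β/4M)v)^{N′}`
    obtain ⟨K, rfl⟩ : ∃ K, N' = K + 1 := ⟨N' - 1, by omega⟩
    have hbulk : ((K + 1 : ℕ) : ℝ) * A (K + 1) * (2 * π * (2 / klE0) ^ (K + 1)) * (2 * π / β) ^ (K + 1 - 1) * ((M : ℝ) / v) ^ (K + 1) / β =
        ((K + 1 : ℕ) : ℝ) * A (K + 1) * (π / klE0) ^ (K + 1) / (β / ((2 * (2 * M) : ℕ) : ℝ) * v) ^ (K + 1) := by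
      rw [Nat.add_sub_cancel, hN4]
      have hβ' := hβ.ne'; have hv' := hvpos.ne'; have hM' := hMpos.ne'; have hE' := hE0.ne'
      simp only [div_pow, mul_pow]
      field_simp
      rw [show ((2 : ℝ) ^ 2) ^ (K + 1) = 2 ^ (K + 1) * 2 ^ (K + 1) by rw [← mul_pow]; norm_num]
      ring
    have hd : 0 < β / ((2 * (2 * M) : ℕ) : ℝ) * v := by rw [hN4]; positivity
    have hA2 : ‖((hubbardGridSub L M β (2 * (2 * M))).transpose * hubbardCovAboveCT L M β μ 0 0 klE0 * hubbardGridSub L M β (2 * (2 * M)))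
        ((p₁, σ), 0) ((p₀, σ), 1)‖ ≤ (∑ i ∈ Finset.range (K + 1), 2 * ((max i 1 : ℕ) : ℝ) * 2 ^ i * A i / π) / v +
        ((K + 1 : ℕ) : ℝ) * A (K + 1) * (π / klE0) ^ (K + 1) / (β / ((2 * (2 * M) : ℕ) : ℝ) * v) ^ (K + 1) := by
      rw [← hbulk]; exact hAbel.trans (add_le_add hedges le_rfl)
    have h := le_add_max_mul_of_bounds (K + 1) hℓ hd hG0 (div_nonneg hEDsum0 hv0) hG hA2
    exact h

/-- **THE DECAY SHAPE OF THE ENTRIES, both orientations, on-site/off-site** (bare frame; `μ ∈ klWindowC`, `klBetaMin ≤ β`, `klEngL₃ β U ≤ L` for the Gram `16`;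
`2k+5 ≤ M`; `ℓ > 0`).  With `v = cyclicDist_{4M}(j_p, j_b)`, `z_c = valMinAbs(x_b − x_p)`, `N′ = k+2`, `n = k+4`, `S_n = Σ'_{z∈ℤ²}(1+‖z‖)^{−n}`, `Tab = klChi2CauchyTab`:
both `‖A((p,σ,+),(b,σ,−))‖` and `‖A((b,σ,+),(p,σ,−))‖` are at most
`[v≠0]·ED(x_b)/v + G′(x_b)·(1+(β/4M)v/ℓ)^{−N′}`, `ED = EDon` / `EDoff·(1+‖z_c‖)^{−n}`, `G′ = max(16, BKon/ℓ^{N′})2^{N′}` / `max(Goff, BKoff/ℓ^{N′})2^{N′}(1+‖z_c‖)^{−n}`. -/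
theorem norm_gridCov_apply_le_decayShape {μ : ℝ} (hμ : μ ∈ klWindowC) {β U : ℝ} (hβ : klBetaMin ≤ β) (hL : klEngL₃ β U ≤ L) (k : ℕ)
    (hM : 2 * (k + 2) + 1 ≤ M) {ℓ : ℝ} (hℓ : 0 < ℓ) (σ : Fin 2) (p b : GridPoint L (2 * (2 * M))) :
    let v : ℝ := cyclicDist (2 * (2 * M)) (((p.1 : ℕ) : ZMod (2 * (2 * M)))) (((b.1 : ℕ) : ZMod (2 * (2 * M))))
    let w : ℝ := ((1 + ‖(fun j => ((b.2 - p.2) j).valMinAbs : Site 2)‖) ^ (k + 4))⁻¹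
    let Aon : ℕ → ℝ := fun i => klChi2CauchyTab (k + 2) * (i + 1) ! * 2 ^ (i + 1)
    let Aoff : ℕ → ℝ := fun i => (k + 4) ! * klChi2CauchyTab (i + (k + 4)) * (i + (k + 4) + 1) ! * 2 ^ (i + 2) * (2 / klE0) *
      (max 1 (4 / klE0)) ^ (k + 4 - 1) * 8 ^ (k + 4) * (1 + (4 : ℝ) ^ (k + 4) * ∑' q : Site 2, ((1 + ‖q‖) ^ (k + 4))⁻¹)
    let Goff : ℝ := 4 * ((k + 4) ! * klChi2CauchyTab (k + 4) * (k + 4 + 1) ! * (max 1 (4 / klE0)) ^ (k + 4 - 1) * 8 ^ (k + 4) *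
      (1 + (4 : ℝ) ^ (k + 4) * ∑' q : Site 2, ((1 + ‖q‖) ^ (k + 4))⁻¹)) * (2 / klE0)
    let shape : ℝ := (if v = 0 then 0 else
        (if b.2 = p.2 then ∑ i ∈ Finset.range (k + 2), 2 * ((max i 1 : ℕ) : ℝ) * 2 ^ i * Aon i / π
          else (∑ i ∈ Finset.range (k + 2), 2 * ((max i 1 : ℕ) : ℝ) * 2 ^ i * Aoff i / π) * w) / v) +
      (if b.2 = p.2 then max 16 ((k + 2 : ℕ) * Aon (k + 2) * (π / klE0) ^ (k + 2) / ℓ ^ (k + 2)) * 2 ^ (k + 2)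
        else max Goff ((k + 2 : ℕ) * Aoff (k + 2) * (π / klE0) ^ (k + 2) / ℓ ^ (k + 2)) * 2 ^ (k + 2) * w) *
        ((1 + β / ((2 * (2 * M) : ℕ) : ℝ) * v / ℓ) ^ (k + 2))⁻¹
    ‖((hubbardGridSub L M β (2 * (2 * M))).transpose * hubbardCovAboveCT L M β μ 0 0 klE0 * hubbardGridSub L M β (2 * (2 * M)))
        ((p, σ), 0) ((b, σ), 1)‖ ≤ shape ∧
    ‖((hubbardGridSub L M β (2 * (2 * M))).transpose * hubbardCovAboveCT L M β μ 0 0 klE0 * hubbardGridSub L M β (2 * (2 * M)))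
        ((b, σ), 0) ((p, σ), 1)‖ ≤ shape := by
  intro v w Aon Aoff Goff shape
  haveI : NeZero (2 * (2 * M)) := ⟨by have := NeZero.ne M; omega⟩
  have hβ0 : 0 < β := lt_of_lt_of_le (by norm_num [klBetaMin]) hβ
  have hE0 : (0 : ℝ) < klE0 := by norm_num [klE0]
  have hN' : 1 ≤ k + 2 := by omega
  have hS0 : ∀ m : ℕ, 0 ≤ ∑' q : Site 2, ((1 + ‖q‖) ^ m)⁻¹ := fun m => tsum_nonneg fun _ => by positivity
  have hT0 : ∀ m : ℕ, 0 ≤ klChi2CauchyTab m := fun m => zero_le_one.trans (one_le_klChi2CauchyTab m)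
  have hAon0 : ∀ i, 0 ≤ Aon i := fun i => by simp only [Aon]; have := hT0 (k + 2); positivity
  have hAoff0 : ∀ i, 0 ≤ Aoff i := fun i => by simp only [Aoff]; have := hT0 (i + (k + 4)); have := hS0 (k + 4); positivity
  have hGoff0 : 0 ≤ Goff := by simp only [Goff]; have := hT0 (k + 4); have := hS0 (k + 4); positivity
  have hw0 : 0 ≤ w := by positivity
  -- symmetry of the cyclic distance and of the centred norm
  have hvsymm : cyclicDist (2 * (2 * M)) (((b.1 : ℕ) : ZMod (2 * (2 * M)))) (((p.1 : ℕ) : ZMod (2 * (2 * M)))) = v :=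
    (isLabelDist_cyclicDist _).symm _ _
  have hzneg : ‖(fun j => ((p.2 - b.2) j).valMinAbs : Site 2)‖ = ‖(fun j => ((b.2 - p.2) j).valMinAbs : Site 2)‖ := by
    rw [show p.2 - b.2 = -(b.2 - p.2) by abel]; exact norm_centredRep_neg _
  -- the sixteen
  have h16 := fun X Y => norm_gridCov_apply_le_sixteen (L := L) (M := M) hμ hβ hL X Y
  -- ONE ORIENTATION, generic in the pair, from brick 4c's jets and uniform bounds
  have horient : ∀ (p₁ p₀ : GridPoint L (2 * (2 * M))),
      ‖((hubbardGridSub L M β (2 * (2 * M))).transpose * hubbardCovAboveCT L M β μ 0 0 klE0 * hubbardGridSub L M β (2 * (2 * M)))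
          ((p₁, σ), 0) ((p₀, σ), 1)‖ ≤
        (if cyclicDist (2 * (2 * M)) (((p₁.1 : ℕ) : ZMod (2 * (2 * M)))) (((p₀.1 : ℕ) : ZMod (2 * (2 * M)))) = 0 then 0 else
          (if p₀.2 = p₁.2 then ∑ i ∈ Finset.range (k + 2), 2 * ((max i 1 : ℕ) : ℝ) * 2 ^ i * Aon i / π
            else (∑ i ∈ Finset.range (k + 2), 2 * ((max i 1 : ℕ) : ℝ) * 2 ^ i * Aoff i / π) *
              ((1 + ‖(fun j => ((p₁.2 - p₀.2) j).valMinAbs : Site 2)‖) ^ (k + 4))⁻¹) /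
            cyclicDist (2 * (2 * M)) (((p₁.1 : ℕ) : ZMod (2 * (2 * M)))) (((p₀.1 : ℕ) : ZMod (2 * (2 * M))))) +
        (if p₀.2 = p₁.2 then max 16 ((k + 2 : ℕ) * Aon (k + 2) * (π / klE0) ^ (k + 2) / ℓ ^ (k + 2)) * 2 ^ (k + 2)
          else max Goff ((k + 2 : ℕ) * Aoff (k + 2) * (π / klE0) ^ (k + 2) / ℓ ^ (k + 2)) * 2 ^ (k + 2) *
            ((1 + ‖(fun j => ((p₁.2 - p₀.2) j).valMinAbs : Site 2)‖) ^ (k + 4))⁻¹) *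
          ((1 + β / ((2 * (2 * M) : ℕ) : ℝ) * cyclicDist (2 * (2 * M)) (((p₁.1 : ℕ) : ZMod (2 * (2 * M)))) (((p₀.1 : ℕ) : ZMod (2 * (2 * M)))) / ℓ)
            ^ (k + 2))⁻¹ := by
    intro p₁ p₀
    by_cases hx : p₀.2 = p₁.2
    · -- on site: representative `z = 0`, jets at every site, Gram `16`
      have hzx : Torus.proj L (0 : Site 2) = p₁.2 - p₀.2 := by
        rw [hx, sub_self]; funext j; simp [Literature.Probability.LatticeModels.Torus.proj_apply]
      have hjet := freqJets_torusFourierInv_allSites (L := L) hE0 μ 0 (k + 2) (Torus.proj L (0 : Site 2))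
      have h := norm_gridCov_apply_le_shape_of_freqJets (L := L) (M := M) hβ0 μ hN' hM p₁ p₀ σ hzx hAon0
        (fun i hi om => hjet i hi om) (by norm_num) (h16 _ _) hℓ
      simp only [if_pos hx]
      exact h
    · -- off site: centred representative, decaying jets, uniform off-site bound
      obtain ⟨hproj, hzL⟩ := two_mul_norm_valMinAbs_le (L := L) (p₁.2 - p₀.2)
      have hx' : p₁.2 ≠ p₀.2 := fun h => hx h.symm
      have hz0 : Torus.proj L (fun j => ((p₁.2 - p₀.2) j).valMinAbs : Site 2) ≠ 0 := by rw [hproj]; exact sub_ne_zero.2 hx'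
      set wz : ℝ := ((1 + ‖(fun j => ((p₁.2 - p₀.2) j).valMinAbs : Site 2)‖) ^ (k + 4))⁻¹ with hwz
      have hwz0 : 0 ≤ wz := by positivity
      have hjet : ∀ i ≤ k + 2, ∀ om : ℝ, ‖iteratedDeriv i (fun om : ℝ => torusFourierInv (fun kv : TorusSite 2 L =>
          (fun y : Momentum => uvSymbolFn 1 klE0 (frameLevel μ 0 ((2 * π) • y)) om) (WithLp.toLp 2 fun i => ((kv i).val : ℝ) / L))
          (Torus.proj L (fun j => ((p₁.2 - p₀.2) j).valMinAbs : Site 2))) om‖ ≤ (Aoff i * wz) / max |om| (klE0 / 2) ^ (i + 1) := by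
        intro i _ om
        have h := freqJets_torusFourierInv_offSite (L := L) hE0 μ (n := k + 4) (by omega) hzL hz0 i om
        refine h.trans (le_of_eq ?_)
        simp only [Aoff, hwz]
      have hGoff := norm_gridCov_apply_le_offSite_uniform (L := L) (M := M) hβ0 μ hE0 p₁ p₀ σ (n := k + 4) (by omega) hzL hproj hx'
      have h := norm_gridCov_apply_le_shape_of_freqJets (L := L) (M := M) hβ0 μ hN' hM p₁ p₀ σ hproj (A := fun i => Aoff i * wz)
        (fun i => mul_nonneg (hAoff0 i) hwz0) hjet (G := Goff * wz) (mul_nonneg hGoff0 hwz0)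
        (hGoff.trans (le_of_eq (by simp only [Goff, hwz]; ring))) hℓ
      simp only [if_neg hx]
      refine h.trans (le_of_eq ?_)
      -- factor the common decay weight `wz` out of the edge sum and the max
      have hsum : ∑ i ∈ Finset.range (k + 2), 2 * ((max i 1 : ℕ) : ℝ) * 2 ^ i * (Aoff i * wz) / π =
          (∑ i ∈ Finset.range (k + 2), 2 * ((max i 1 : ℕ) : ℝ) * 2 ^ i * Aoff i / π) * wz := by
        rw [Finset.sum_mul]; exact Finset.sum_congr rfl fun i _ => by ring
      have hmax : max (Goff * wz) (((k + 2 : ℕ) : ℝ) * (Aoff (k + 2) * wz) * (π / klE0) ^ (k + 2) / ℓ ^ (k + 2)) * 2 ^ (k + 2) =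
          max Goff (((k + 2 : ℕ) : ℝ) * Aoff (k + 2) * (π / klE0) ^ (k + 2) / ℓ ^ (k + 2)) * 2 ^ (k + 2) * wz := by
        rw [show ((k + 2 : ℕ) : ℝ) * (Aoff (k + 2) * wz) * (π / klE0) ^ (k + 2) / ℓ ^ (k + 2) =
            ((k + 2 : ℕ) : ℝ) * Aoff (k + 2) * (π / klE0) ^ (k + 2) / ℓ ^ (k + 2) * wz by ring, ← max_mul_of_nonneg _ _ hwz0]
        ring
      rw [hsum, hmax]
  refine ⟨?_, ?_⟩
  · -- orientation `(p, b)`: rewrite the centred norm through `‖z_c(x_p − x_b)‖ = ‖z_c(x_b − x_p)‖`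
    have h := horient p b
    rw [hzneg] at h
    exact h
  · -- orientation `(b, p)`: the cyclic distance is symmetric, the on-site condition is symmetric
    have h := horient b p
    have hx : (p.2 = b.2) = (b.2 = p.2) := propext eq_comm
    simp only [hvsymm, hx] at h
    exact h

end Summit.HubbardSuperconductivity.HubbardSuperconductivity.Theorems.KLRegimeSplit

end
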